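import Literature.MathematicalPhysics.QuantumManyBody.BoseGasFreeDirichletBEC
import Literature.MathematicalPhysics.QuantumManyBody.BoseGasCutoffStateOccupation
import Literature.MathematicalPhysics.QuantumManyBody.DyadicCoherentFractionRefinement
import Literature.MathematicalPhysics.QuantumManyBody.PeriodicBoseGasFourier
import Literature.Analysis.FluidPDE.PoincareBall
import HarnessLib

/-!
# Route BECBathMassLiouville — `FrozenBathNoBEC` (stmt-AtomisticToContinuum-13803), helper file 2:
# Neumann bracketing into sub-cells and the flat-mode weight

Deterministic part of the frozen-bath no-BEC statement, on the one-body level and on `ℝ³`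
(`Space`): the big cell `[0,kℓ)³` is tiled by the `k³` sub-cells `subCell ℓ q` of side `ℓ`
(`BoseGasFreeDirichletBEC`). Given

* a set `O` of "occupied" sub-cells on each of which the local mass bound
  `W₀ ∫_Q |f|² ≤ 4ℓ³ ∫_Q (|∇f|² + V|f|²)` holds (helper file 1 supplies it from a scatterer inside),
* a small quenched energy `∫_{cell} (|∇f|² + V|f|²) ≤ 2η`,
* few unoccupied sub-cells `#Oᶜ ≤ εk³/4`, and `32ℓ³η ≤ W₀ε`,

a normalised `f` has flat-mode weight `L⁻³|∫_{cell} f|² ≤ ε` (`weight_le_of_good`): mass on the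
occupied region is `≤ 8ℓ³η/W₀`, the unoccupied region has volume fraction `≤ ε/4`, and
Cauchy–Schwarz on the two pieces gives `|∫f|²/L³ ≤ 2·mass_occ + 2·frac_unocc`.

References: LSSY2005 §1.2 (objects); the argument is elementary (Neumann bracketing, as in the
informal statement of the item).
-/

noncomputable section

namespace Summit.AtomisticToContinuum.BoseEinsteinCondensation.Theorems.FrozenBath

open MeasureTheory Metric Set Filter
open scoped ENNReal NNReal
open Literature.MathematicalPhysics.QuantumManyBody.BoseGas

variable {k : ℕ} {ℓ : ℝ}

/-- `|ℓq + [0,ℓ)³| = ℓ³`. [folklore] -/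
theorem volume_subCell (ℓ : ℝ) (q : SubIdx k) : volume (subCell ℓ q) = ENNReal.ofReal ℓ ^ 3 :=
  volume_cellShift ℓ _

/-- The sub-cells cover the big cell exactly: `⋃_q Q_q = [0,kℓ)³` (`ℓ > 0`). [folklore] -/
theorem iUnion_subCell_eq_cell (hℓ : 0 < ℓ) : ⋃ q : SubIdx k, subCell ℓ q = cell (k * ℓ) := by
  ext x
  simp only [mem_iUnion]
  constructor
  · rintro ⟨q, hq⟩
    exact subCell_subset_cell hℓ q hq
  · intro hx
    exact exists_mem_subCell hℓ hx

/-- Distinct sub-cells are disjoint, as a `PairwiseDisjoint` family (`ℓ > 0`). [folklore] -/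
theorem pairwiseDisjoint_subCell (hℓ : 0 < ℓ) (s : Set (SubIdx k)) :
    s.PairwiseDisjoint (subCell ℓ) :=
  fun _ _ _ _ hne => Set.disjoint_left.2 fun _ hx hx' => not_mem_subCell_of_ne hℓ hne hx hx'

/-- The union of the sub-cells of a finset and the union over its complement are disjoint.
[folklore] -/
theorem disjoint_biUnion_subCell_compl (hℓ : 0 < ℓ) (O : Finset (SubIdx k)) :
    Disjoint (⋃ q ∈ O, subCell ℓ q) (⋃ q ∈ (Finset.univ \ O), subCell ℓ q) := by
  rw [Set.disjoint_iUnion₂_left]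
  intro q hq
  rw [Set.disjoint_iUnion₂_right]
  intro q' hq'
  have hne : q ≠ q' := by
    rintro rfl
    exact (Finset.mem_sdiff.1 hq').2 hq
  exact Set.disjoint_left.2 fun _ hx hx' => not_mem_subCell_of_ne hℓ hne hx hx'

/-- The occupied and the unoccupied sub-cells together cover the big cell. [folklore] -/
theorem biUnion_subCell_union_compl (hℓ : 0 < ℓ) (O : Finset (SubIdx k)) :
    (⋃ q ∈ O, subCell ℓ q) ∪ (⋃ q ∈ (Finset.univ \ O), subCell ℓ q) = cell (k * ℓ) := by
  rw [← iUnion_subCell_eq_cell hℓ]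
  ext x
  simp only [mem_union, mem_iUnion, exists_prop, Finset.mem_sdiff, Finset.mem_univ, true_and]
  constructor
  · rintro (⟨q, -, hq⟩ | ⟨q, -, hq⟩) <;> exact ⟨q, hq⟩
  · rintro ⟨q, hq⟩
    by_cases h : q ∈ O
    · exact Or.inl ⟨q, h, hq⟩
    · exact Or.inr ⟨q, h, hq⟩

/-- A finite union of sub-cells is measurable. [folklore] -/
theorem measurableSet_biUnion_subCell (ℓ : ℝ) (O : Finset (SubIdx k)) :
    MeasurableSet (⋃ q ∈ O, subCell ℓ q) :=
  Finset.measurableSet_biUnion O fun q _ => measurableSet_subCell ℓ q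

/-- **Mass on the occupied cells (Neumann bracketing).** If on every cell of `O` the local bound
`W₀ ∫_Q |f|² ≤ C ∫_Q (|∇f|² + V|f|²)` holds, then, the cells being disjoint pieces of `[0,kℓ)³`,
`W₀ ∫_{⋃O} |f|² ≤ C ∫_{[0,kℓ)³} (|∇f|² + V|f|²)`. [folklore] -/
theorem mass_occupied_le (hℓ : 0 < ℓ) {f : Space → ℂ} (hf : Continuous f) {V : Space → ℝ≥0∞}
    (hV : Measurable V) (O : Finset (SubIdx k)) {W₀ C : ℝ≥0∞}
    (hO : ∀ q ∈ O, W₀ * ∫⁻ x in subCell ℓ q, (‖f x‖₊ : ℝ≥0∞) ^ 2 ≤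
      C * ∫⁻ x in subCell ℓ q, (gradSqC f x + V x * (‖f x‖₊ : ℝ≥0∞) ^ 2)) :
    W₀ * ∫⁻ x in ⋃ q ∈ O, subCell ℓ q, (‖f x‖₊ : ℝ≥0∞) ^ 2 ≤
      C * ∫⁻ x in cell (k * ℓ), (gradSqC f x + V x * (‖f x‖₊ : ℝ≥0∞) ^ 2) := by
  have hm : AEMeasurable (fun x => gradSqC f x + V x * (‖f x‖₊ : ℝ≥0∞) ^ 2) volume :=
    ((measurable_gradSqC_any f).add
      (hV.mul ((hf.measurable.nnnorm.coe_nnreal_ennreal).pow_const 2))).aemeasurable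
  rw [lintegral_biUnion_finset (pairwiseDisjoint_subCell hℓ _) (fun q _ => measurableSet_subCell ℓ q),
    Finset.mul_sum]
  calc ∑ q ∈ O, W₀ * ∫⁻ x in subCell ℓ q, (‖f x‖₊ : ℝ≥0∞) ^ 2
      ≤ ∑ q ∈ O, C * ∫⁻ x in subCell ℓ q, (gradSqC f x + V x * (‖f x‖₊ : ℝ≥0∞) ^ 2) :=
        Finset.sum_le_sum hO
    _ = C * ∑ q ∈ O, ∫⁻ x in subCell ℓ q, (gradSqC f x + V x * (‖f x‖₊ : ℝ≥0∞) ^ 2) := by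
        rw [Finset.mul_sum]
    _ ≤ C * ∑ q : SubIdx k, ∫⁻ x in subCell ℓ q, (gradSqC f x + V x * (‖f x‖₊ : ℝ≥0∞) ^ 2) := by
        refine mul_le_mul_right (Finset.sum_le_sum_of_subset_of_nonneg (Finset.subset_univ O) ?_) _
        intro q _ _
        exact zero_le
    _ = C * ∫⁻ x in cell (k * ℓ), (gradSqC f x + V x * (‖f x‖₊ : ℝ≥0∞) ^ 2) := by
        rw [sum_setLIntegral_subCell hℓ hm]

/-- **Cauchy–Schwarz for the flat-mode weight on the two regions.** For continuous `f` and any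
set `O` of sub-cells,
`|∫_{[0,kℓ)³} f|² ≤ 2 |[0,kℓ)³| ∫_{⋃O} |f|² + 2 (#Oᶜ ℓ³) ∫_{[0,kℓ)³} |f|²`
(split `∫ f` over the occupied and unoccupied unions, `‖a+b‖² ≤ 2‖a‖² + 2‖b‖²`, and
`‖∫_S f‖² ≤ |S| ∫_S |f|²` on each). [folklore] -/
theorem weight_sq_le (hℓ : 0 < ℓ) {f : Space → ℂ} (hf : Continuous f) (O : Finset (SubIdx k)) :
    ((‖∫ x in cell (k * ℓ), f x‖₊ : ℝ≥0∞) ^ 2) ≤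
      2 * (volume (cell (k * ℓ)) * ∫⁻ x in ⋃ q ∈ O, subCell ℓ q, (‖f x‖₊ : ℝ≥0∞) ^ 2) +
        2 * (((Finset.univ \ O).card : ℝ≥0∞) * ENNReal.ofReal ℓ ^ 3 *
          ∫⁻ x in cell (k * ℓ), (‖f x‖₊ : ℝ≥0∞) ^ 2) := by
  set S := ⋃ q ∈ O, subCell ℓ q with hS
  set U := ⋃ q ∈ (Finset.univ \ O), subCell ℓ q with hU
  have hSU : S ∪ U = cell (k * ℓ) := biUnion_subCell_union_compl hℓ O
  have hdisj : Disjoint S U := disjoint_biUnion_subCell_compl hℓ O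
  have hUm : MeasurableSet U := measurableSet_biUnion_subCell ℓ _
  have hfi : IntegrableOn f (cell (k * ℓ)) volume := integrableOn_cell hf
  have hfS : IntegrableOn f S volume := hfi.mono_set (hSU ▸ subset_union_left)
  have hfU : IntegrableOn f U volume := hfi.mono_set (hSU ▸ subset_union_right)
  have hfm : AEMeasurable f (volume.restrict S) := hf.measurable.aemeasurable
  have hfm' : AEMeasurable f (volume.restrict U) := hf.measurable.aemeasurable
  have hSvol : volume S ≤ volume (cell (k * ℓ)) := measure_mono (hSU ▸ subset_union_left)
  have hUvol : volume U ≤ ((Finset.univ \ O).card : ℝ≥0∞) * ENNReal.ofReal ℓ ^ 3 := by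
    calc volume U ≤ ∑ q ∈ (Finset.univ \ O), volume (subCell ℓ q) :=
          measure_biUnion_finset_le _ _
      _ = ((Finset.univ \ O).card : ℝ≥0∞) * ENNReal.ofReal ℓ ^ 3 := by
          simp only [volume_subCell, Finset.sum_const, nsmul_eq_mul]
  have hUint : ∫⁻ x in U, (‖f x‖₊ : ℝ≥0∞) ^ 2 ≤ ∫⁻ x in cell (k * ℓ), (‖f x‖₊ : ℝ≥0∞) ^ 2 :=
    lintegral_mono_set (hSU ▸ subset_union_right)
  have hCS_S : ((‖∫ x in S, f x‖₊ : ℝ≥0∞) ^ 2) ≤ volume S * ∫⁻ x in S, (‖f x‖₊ : ℝ≥0∞) ^ 2 := by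
    have h := nnnorm_integral_sq_le_mul_lintegral (volume.restrict S) hfm
    rwa [Measure.restrict_apply_univ] at h
  have hCS_U : ((‖∫ x in U, f x‖₊ : ℝ≥0∞) ^ 2) ≤ volume U * ∫⁻ x in U, (‖f x‖₊ : ℝ≥0∞) ^ 2 := by
    have h := nnnorm_integral_sq_le_mul_lintegral (volume.restrict U) hfm'
    rwa [Measure.restrict_apply_univ] at h
  rw [← hSU, setIntegral_union hdisj hUm hfS hfU]
  calc ((‖(∫ x in S, f x) + ∫ x in U, f x‖₊ : ℝ≥0∞) ^ 2)
      ≤ ((‖∫ x in S, f x‖₊ : ℝ≥0∞) + ‖∫ x in U, f x‖₊) ^ 2 := by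
        gcongr
        exact_mod_cast nnnorm_add_le _ _
    _ ≤ 2 * (‖∫ x in S, f x‖₊ : ℝ≥0∞) ^ 2 + 2 * (‖∫ x in U, f x‖₊ : ℝ≥0∞) ^ 2 :=
        Literature.Analysis.FluidPDE.PoincareBall.add_sq_le_two_mul_sq_add _ _
    _ ≤ 2 * (volume S * ∫⁻ x in S, (‖f x‖₊ : ℝ≥0∞) ^ 2) +
          2 * (volume U * ∫⁻ x in U, (‖f x‖₊ : ℝ≥0∞) ^ 2) := by gcongr
    _ ≤ 2 * (volume (S ∪ U) * ∫⁻ x in S, (‖f x‖₊ : ℝ≥0∞) ^ 2) +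
          2 * (((Finset.univ \ O).card : ℝ≥0∞) * ENNReal.ofReal ℓ ^ 3 *
            ∫⁻ x in S ∪ U, (‖f x‖₊ : ℝ≥0∞) ^ 2) := by
        rw [hSU]
        gcongr

/-- **Good configurations carry no condensate (deterministic core of `FrozenBathNoBEC`).**
On the big cell `[0,L)³`, `L = kℓ`, let `f` be continuous and normalised, `V ≥ 0` measurable, `O` a
set of sub-cells on each of which the local mass bound with constant `W₀ ∈ (0,∞)` holds. If the
quenched energy is `≤ 2η`, the number of other sub-cells is `≤ εk³/4`, and `32ℓ³η ≤ W₀ε`, then the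
flat-mode weight is small: `L⁻³ |∫_{[0,L)³} f|² ≤ ε`. [folklore] -/
theorem weight_le_of_good (hℓ : 0 < ℓ) (hk : 1 ≤ k) {f : Space → ℂ} (hf : Continuous f)
    {V : Space → ℝ≥0∞} (hV : Measurable V) (O : Finset (SubIdx k)) {W₀ : ℝ≥0∞} (hW0 : W₀ ≠ 0)
    (hWt : W₀ ≠ ⊤) {ε η : ℝ} (hε : 0 ≤ ε)
    (hO : ∀ q ∈ O, W₀ * ∫⁻ x in subCell ℓ q, (‖f x‖₊ : ℝ≥0∞) ^ 2 ≤
      ENNReal.ofReal (4 * ℓ ^ 3) * ∫⁻ x in subCell ℓ q, (gradSqC f x + V x * (‖f x‖₊ : ℝ≥0∞) ^ 2))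
    (hE : ∫⁻ x in cell (k * ℓ), (gradSqC f x + V x * (‖f x‖₊ : ℝ≥0∞) ^ 2) ≤
      ENNReal.ofReal (2 * η))
    (hU : (((Finset.univ \ O).card : ℕ) : ℝ) ≤ ε * (k : ℝ) ^ 3 / 4)
    (hηε : ENNReal.ofReal (32 * ℓ ^ 3 * η) ≤ W₀ * ENNReal.ofReal ε)
    (hnorm : ∫⁻ x in cell (k * ℓ), (‖f x‖₊ : ℝ≥0∞) ^ 2 = 1) :
    (ENNReal.ofReal (k * ℓ) ^ 3)⁻¹ * (‖∫ x in cell (k * ℓ), f x‖₊ : ℝ≥0∞) ^ 2 ≤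
      ENNReal.ofReal ε := by
  set L : ℝ := k * ℓ with hLdef
  have hkpos : (0 : ℝ) < k := by exact_mod_cast hk
  have hL : 0 < L := mul_pos hkpos hℓ
  have hL3 : ENNReal.ofReal L ^ 3 ≠ 0 := pow_ne_zero _ (by simpa using hL)
  have hL3t : ENNReal.ofReal L ^ 3 ≠ ⊤ := ENNReal.pow_ne_top ENNReal.ofReal_ne_top
  set mS : ℝ≥0∞ := ∫⁻ x in ⋃ q ∈ O, subCell ℓ q, (‖f x‖₊ : ℝ≥0∞) ^ 2 with hmS
  -- mass on the occupied region
  have hmass : W₀ * mS ≤ ENNReal.ofReal (4 * ℓ ^ 3) * ENNReal.ofReal (2 * η) :=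
    (mass_occupied_le hℓ hf hV O hO).trans (mul_le_mul_right hE _)
  have h2 : (2 : ℝ≥0∞) = ENNReal.ofReal 2 := by norm_num
  have hi : 2 * mS ≤ ENNReal.ofReal (ε / 2) := by
    have h : 2 * mS * W₀ ≤ ENNReal.ofReal (ε / 2) * W₀ := by
      calc 2 * mS * W₀ = 2 * (W₀ * mS) := by ring
        _ ≤ 2 * (ENNReal.ofReal (4 * ℓ ^ 3) * ENNReal.ofReal (2 * η)) := by gcongr
        _ = ENNReal.ofReal (1 / 2) * ENNReal.ofReal (32 * ℓ ^ 3 * η) := by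
            rw [h2, ← ENNReal.ofReal_mul (by positivity : (0 : ℝ) ≤ 4 * ℓ ^ 3),
              ← ENNReal.ofReal_mul (by positivity : (0 : ℝ) ≤ 2),
              ← ENNReal.ofReal_mul (by positivity : (0 : ℝ) ≤ 1 / 2)]
            congr 1
            ring
        _ ≤ ENNReal.ofReal (1 / 2) * (W₀ * ENNReal.ofReal ε) := by gcongr
        _ = ENNReal.ofReal (ε / 2) * W₀ := by
            rw [mul_comm W₀, ← mul_assoc, ← ENNReal.ofReal_mul (by norm_num)]
            congr 2
            ring
    exact (ENNReal.mul_le_mul_iff_left hW0 hWt).1 h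
  -- the unoccupied region
  have hii : 2 * ((((Finset.univ \ O).card : ℕ) : ℝ≥0∞) * ENNReal.ofReal ℓ ^ 3 *
      ∫⁻ x in cell (k * ℓ), (‖f x‖₊ : ℝ≥0∞) ^ 2) ≤
      ENNReal.ofReal (ε / 2) * ENNReal.ofReal L ^ 3 := by
    rw [hnorm, mul_one]
    have hℓ3 : (0 : ℝ) ≤ ℓ ^ 3 := by positivity
    have hreal : 2 * ((((Finset.univ \ O).card : ℕ) : ℝ) * ℓ ^ 3) ≤ ε / 2 * L ^ 3 := by
      calc 2 * ((((Finset.univ \ O).card : ℕ) : ℝ) * ℓ ^ 3) ≤ 2 * (ε * (k : ℝ) ^ 3 / 4 * ℓ ^ 3) := by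
            gcongr
        _ = ε / 2 * L ^ 3 := by rw [hLdef]; ring
    calc 2 * ((((Finset.univ \ O).card : ℕ) : ℝ≥0∞) * ENNReal.ofReal ℓ ^ 3)
        = ENNReal.ofReal (2 * ((((Finset.univ \ O).card : ℕ) : ℝ) * ℓ ^ 3)) := by
          rw [ENNReal.ofReal_mul (by norm_num), ENNReal.ofReal_mul (by positivity),
            ENNReal.ofReal_pow hℓ.le, ENNReal.ofReal_natCast, ENNReal.ofReal_ofNat]
      _ ≤ ENNReal.ofReal (ε / 2 * L ^ 3) := ENNReal.ofReal_le_ofReal hreal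
      _ = ENNReal.ofReal (ε / 2) * ENNReal.ofReal L ^ 3 := by
          rw [ENNReal.ofReal_mul (by positivity), ENNReal.ofReal_pow hL.le]
  -- combine
  have hX : ((‖∫ x in cell (k * ℓ), f x‖₊ : ℝ≥0∞) ^ 2) ≤ ENNReal.ofReal ε * ENNReal.ofReal L ^ 3 := by
    calc ((‖∫ x in cell (k * ℓ), f x‖₊ : ℝ≥0∞) ^ 2)
        ≤ 2 * (volume (cell (k * ℓ)) * mS) +
            2 * ((((Finset.univ \ O).card : ℕ) : ℝ≥0∞) * ENNReal.ofReal ℓ ^ 3 *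
              ∫⁻ x in cell (k * ℓ), (‖f x‖₊ : ℝ≥0∞) ^ 2) := weight_sq_le hℓ hf O
      _ ≤ ENNReal.ofReal L ^ 3 * ENNReal.ofReal (ε / 2) +
            ENNReal.ofReal (ε / 2) * ENNReal.ofReal L ^ 3 := by
          refine add_le_add ?_ hii
          rw [volume_cell, ← hLdef, mul_left_comm]
          exact mul_le_mul_right hi _
      _ = ENNReal.ofReal ε * ENNReal.ofReal L ^ 3 := by
          rw [mul_comm (ENNReal.ofReal L ^ 3), ← add_mul, ← ENNReal.ofReal_add (by positivity)
            (by positivity), add_halves]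
  calc (ENNReal.ofReal L ^ 3)⁻¹ * (‖∫ x in cell (k * ℓ), f x‖₊ : ℝ≥0∞) ^ 2
      ≤ (ENNReal.ofReal L ^ 3)⁻¹ * (ENNReal.ofReal ε * ENNReal.ofReal L ^ 3) :=
        mul_le_mul_right hX _
    _ = ENNReal.ofReal ε := by
        rw [mul_comm (ENNReal.ofReal ε), ← mul_assoc, ENNReal.inv_mul_cancel hL3 hL3t, one_mul]

end Summit.AtomisticToContinuum.BoseEinsteinCondensation.Theorems.FrozenBath

end
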